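import Summits.PneNP.PneNP.Theorems.ChebyshevTracialDesignPairContainmentLowDegreeFields
import Summits.PneNP.PneNP.Theorems.ChebyshevTracialDesignExtendedSignMatchingSide
import Summits.PneNP.PneNP.Theorems.ChebyshevTracialDesignPureStateReduction
import HarnessLib

/-!
# Cell pnp-psdrank, route `ChebyshevTracialDesign`: LOCAL DIRECTION FIELDS UP TO LINEAR WINDOW SIZE ARE PRICED FOR EVERY MASK — the
# all-modes regime of brick 164: fields of matching-degree `≤ j` with `D/2 ≤ j+1 ≤ c'/2` (`t = 2c'+1`), pinned stars `|S| ≤ j`, windows `|H| ≤ j`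
# (crux `TracialDecayExp20`, stmt-PneNP-19878)

Brick 164b (prover g32; MEMO-35 §2). Brick 164 (`…PairContainmentLowDegreeFields`) prices the pair-containment form `Σ_U Σ_M W f C_{v_M}²` at `≤ 0`
EXACTLY for every mask `f ≥ 0` and every direction field of matching-degree `≤ j` as long as `2(j+1) ≤ D` (exactness at the virtual level). Beyond
the design degree the matching-side SIGN cell at ALL degrees (brick 93, `…ExtendedSignMatchingSide.value_le_of_lowDegreeM_allModes`: matching-degree
`k ≤ c'/2`, contraction-normalised, value `≤ r·(B_v√P_{D/2} + 2^{2k+1}√P_k + Σ_{κ∈(D/2,k]} R_κ√A_κ)`) replaces exactness, at the price of the cell's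
attenuation tail. With brick 164's encoding (cut side `(f(U)/(G n²))·α_Uα_Uᵀ ⪯ I`, `α_U` the pair indicator of `U`; matching side
`(1/√n)·(v_M(a)·1[{a,b} ∈ M])_{(a,b)}` of norm `≤ 1` and matching-degree `≤ j+1`; dimension `r = n²`):
* §1 `pairIndicator_dot_le`, `fieldEdge_dot_le` — the two normalisations (`‖α_U‖² ≤ n²`, `Σ_{(a,b)} v_M(a)²1[{a,b}∈M] = Σ_a v_M(a)² ≤ n`).
* §2 **`sum_containment_sq_le_of_lowDegreeField_allModes`** — `n` even, `(C, w)` an exact design of degree `D ≤ 2c'` on the `(2c'+1)`-cuts, a mask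
  `0 ≤ f ≤ G`, a field `|v_M(p)| ≤ 1` of matching-degree `≤ j` with `D ≤ 2(j+1)`, `2(j+1) ≤ c'`, `6(j+1)+1 ≤ 2c'+1`, `6(j+1)+1 ≤ n−(2c'+1)`:
  `Σ_U Σ_M W(U,M) f(U) C_{v_M}(U)² ≤ G·n⁵·(B_v√P_{D/2} + 2^{2j+3}√P_{j+1} + Σ_{κ∈(D/2, j+1]} R_κ√A_κ)`, `P_k = Π_{i≤k}(2i+1)/(n−2i)`,
  `R_κ = Π_{i<κ}(t−2i)(n−t−2i)/((t−1−2i)(n−t−1−2i))`, `A_κ = Π_{i<κ}(2i+1)/(n−2i)` — exponentially small in `D` for the route's designs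
  (MEMO-21 §4 calibration: every term `≤ (B_v+5)√P_D` while `5k+4 < n`).
* §3 **`sum_star_containment_sq_le_allModes`** (pinned stars `Σ_U Σ_{M ⊇ S} W f C_u²`, `|S| ≤ j`, `|u| ≤ 1`) and
  **`sum_containment_sq_le_of_local_allModes`** (fields depending on `M` only through the partners of a window `H`, `|H| ≤ j`).
READING. Together with brick 164: a direction field that reads the matching only at a window of size up to `≈ t/4` (a LINEAR number of vertices) is
priced for EVERY mask, `M`-summed, at the cell's tail scale; by brick 165 the open heart of the amplitude-one rung is per-cut virtual nonpositivity
for fields that are GLOBAL functions of the matching. [cite: Potechin2019, Thm. 1.2 (LIPIcs 124, 61:4)] [cite: Grigoriev2001, Lemma 1.4 (PDF p. 8)]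
[cite: Rothvoss2017, §2 (PDF p. 6)] [cite: GriblingDelaatLaurent2019, §5]
Stature: support/instrument (kernel lane, no defs, axioms standard). WHAT THIS IS NOT: nothing on `M`-global fields, no proof or refutation of
`TracialDecayExp20`, nothing on psd rank of P_PM(K_n) beyond the rungs, no P-vs-NP content. Supports stmt-PneNP-19878.
-/

set_option linter.dupNamespace false -- `Summit.PneNP.PneNP.…`: summit = sub-problem (D-0017)

noncomputable section

namespace Summit.PneNP.PneNP.Theorems.ChebyshevTracialDesignPairContainmentLocalFieldsAllModes

open Finset Matrix Literature.Barriers.PneNP Literature.Combinatorics.Optimization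
open Summit.PneNP.PneNP.Theorems.ChebyshevTracialDesignExtendedSignMatchingSide (value_le_of_lowDegreeM_allModes)
open Summit.PneNP.PneNP.Theorems.ChebyshevTracialDesignPureStateReduction (posSemidef_vecMulVec posSemidef_one_sub_vecMulVec
  trace_vecMulVec_mul_vecMulVec')
open Summit.PneNP.PneNP.Theorems.ChebyshevTracialDesignPairContainmentAverage (containment_eq_pairing sum_ite_mem_eq_partner)
open Summit.PneNP.PneNP.Theorems.ChebyshevTracialDesignPairContainmentLowDegreeFields (mul_edgeIndicator_mem_span smul_indicator_mem_span
  local_mem_span)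

variable {n : ℕ}

/-! ### §1 The two normalisations -/

/-- The pair indicator `α_U(a,b) = x_a x_b` has `‖α_U‖² ≤ n²`. [folklore] -/
theorem pairIndicator_dot_le (U : OddSet n) :
    (fun i : Fin (n * n) => (if (finProdFinEquiv.symm i).1 ∈ U.1 then (1 : ℝ) else 0) *
        (if (finProdFinEquiv.symm i).2 ∈ U.1 then (1 : ℝ) else 0)) ⬝ᵥ
      (fun i : Fin (n * n) => (if (finProdFinEquiv.symm i).1 ∈ U.1 then (1 : ℝ) else 0) *
        (if (finProdFinEquiv.symm i).2 ∈ U.1 then (1 : ℝ) else 0)) ≤ (n : ℝ) ^ 2 := by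
  classical
  unfold dotProduct
  calc ∑ i : Fin (n * n), ((if (finProdFinEquiv.symm i).1 ∈ U.1 then (1 : ℝ) else 0) *
          (if (finProdFinEquiv.symm i).2 ∈ U.1 then (1 : ℝ) else 0)) *
        ((if (finProdFinEquiv.symm i).1 ∈ U.1 then (1 : ℝ) else 0) * (if (finProdFinEquiv.symm i).2 ∈ U.1 then (1 : ℝ) else 0))
      ≤ ∑ _i : Fin (n * n), (1 : ℝ) := sum_le_sum fun i _ => by
        split_ifs <;> norm_num
    _ = (n : ℝ) ^ 2 := by simp [sq]

/-- For a field `|v_M(p)| ≤ 1`: `Σ_{(a,b)} (v_M(a)·1[{a,b} ∈ M])² = Σ_a v_M(a)² ≤ n` (every vertex has exactly one partner). [folklore] -/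
theorem fieldEdge_dot_le (M : PMatch n) (v : Fin n → ℝ) (hv : ∀ p, |v p| ≤ 1) :
    (fun i : Fin (n * n) => v (finProdFinEquiv.symm i).1 *
        (if s((finProdFinEquiv.symm i).1, (finProdFinEquiv.symm i).2) ∈ M.1 then (1 : ℝ) else 0)) ⬝ᵥ
      (fun i : Fin (n * n) => v (finProdFinEquiv.symm i).1 *
        (if s((finProdFinEquiv.symm i).1, (finProdFinEquiv.symm i).2) ∈ M.1 then (1 : ℝ) else 0)) ≤ (n : ℝ) := by
  classical
  unfold dotProduct
  rw [← finProdFinEquiv.sum_comp]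
  simp only [Equiv.symm_apply_apply, Fintype.sum_prod_type]
  have hrow : ∀ a : Fin n, ∑ b : Fin n, (v a * (if s(a, b) ∈ M.1 then (1 : ℝ) else 0)) * (v a * (if s(a, b) ∈ M.1 then (1 : ℝ) else 0)) =
      v a ^ 2 := by
    intro a
    have h1 : ∀ b : Fin n, (v a * (if s(a, b) ∈ M.1 then (1 : ℝ) else 0)) * (v a * (if s(a, b) ∈ M.1 then (1 : ℝ) else 0)) =
        (if s(a, b) ∈ M.1 then v a ^ 2 else 0) := fun b => by split_ifs <;> ring
    simp_rw [h1]
    exact sum_ite_mem_eq_partner M a (fun _ => v a ^ 2)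
  simp_rw [hrow]
  calc ∑ a : Fin n, v a ^ 2 ≤ ∑ _a : Fin n, (1 : ℝ) := sum_le_sum fun a _ => by
        have h := abs_le.1 (hv a)
        nlinarith [h.1, h.2]
    _ = n := by simp

/-! ### §2 Fields of matching-degree `≤ j` with `D/2 ≤ j+1 ≤ c'/2` -/

/-- **LOW MATCHING-DEGREE FIELDS BEYOND THE DESIGN DEGREE (all modes).** Let `n` be even, `(C, w)` an exact design of degree `D ≤ 2c'` on the
`(2c'+1)`-cuts with variation `≤ B_v`, `0 ≤ f ≤ G` a mask and `v` a direction field with `|v_M(p)| ≤ 1` whose coordinates have matching-degree `≤ j`,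
where `D ≤ 2(j+1)`, `2(j+1) ≤ c'`, `6(j+1)+1 ≤ 2c'+1`, `6(j+1)+1 ≤ n − (2c'+1)`. Then
`Σ_U Σ_M W(U,M) f(U) C_{v_M}(U)² ≤ G·n⁵·(B_v√P_{D/2} + 2^{2(j+1)+1}√P_{j+1} + Σ_{κ∈(D/2,j+1]} R_κ√A_κ)`.
[cite: Potechin2019, Thm. 1.2 (LIPIcs 124, 61:4)] [cite: Grigoriev2001, Lemma 1.4 (PDF p. 8)] [cite: Rothvoss2017, §2 (PDF p. 6)] -/
theorem sum_containment_sq_le_of_lowDegreeField_allModes {c' T D : ℕ} {Bv : ℝ} {C : Finset ℕ} {w : ℕ → ℝ} (hn : Even n)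
    (hdes : IsExactDesign n (2 * c' + 1) T D Bv C w) (hD : D ≤ 2 * c') {j : ℕ} (hDj : D ≤ 2 * (j + 1)) (hjc : 2 * (j + 1) ≤ c')
    (hjt : 6 * (j + 1) + 1 ≤ 2 * c' + 1) (hjnt : 6 * (j + 1) + 1 ≤ n - (2 * c' + 1))
    (f : OddSet n → ℝ) {G : ℝ} (hf0 : ∀ U, 0 ≤ f U) (hfG : ∀ U, f U ≤ G) (v : PMatch n → Fin n → ℝ) (hv1 : ∀ M p, |v M p| ≤ 1)
    (hv : ∀ p, (fun M : PMatch n => v M p) ∈ Submodule.span ℝ (Set.range fun F : {F : Finset (Sym2 (Fin n)) // F.card ≤ j} =>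
      fun M : PMatch n => if F.1 ⊆ M.1 then (1 : ℝ) else 0)) :
    ∑ U : OddSet n, ∑ M : PMatch n, levelWeight n (2 * c' + 1) C w U M *
      (f U * (∑ p, v M p * ((if p ∈ U.1 then (1 : ℝ) else 0) * (if M.2.partner p ∈ U.1 then (1 : ℝ) else 0))) ^ 2) ≤
      G * (n : ℝ) ^ 5 * (Bv * Real.sqrt (∏ i ∈ range (D / 2 + 1), ((2 * i + 1 : ℝ) / ((n : ℝ) - 2 * i))) +
        2 ^ (2 * (j + 1) + 1) * Real.sqrt (∏ i ∈ range (j + 1 + 1), ((2 * i + 1 : ℝ) / ((n : ℝ) - 2 * i))) +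
        ∑ κ ∈ Ico (D / 2 + 1) (j + 1 + 1),
          (∏ i ∈ range κ, (((2 * c' + 1 : ℝ) - 2 * i) * ((n : ℝ) - 2 * c' - 1 - 2 * i) /
              (((2 * c' : ℝ) - 2 * i) * ((n : ℝ) - 2 * c' - 2 - 2 * i)))) *
            Real.sqrt (∏ i ∈ range κ, ((2 * i + 1 : ℝ) / ((n : ℝ) - 2 * i)))) := by
  classical
  -- notation
  set N : ℝ := (n : ℝ) with hN
  have hn1 : 1 ≤ n := by omega
  have hNpos : 0 < N := by rw [hN]; exact_mod_cast (show 0 < n by omega)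
  set tail : ℝ := (Bv * Real.sqrt (∏ i ∈ range (D / 2 + 1), ((2 * i + 1 : ℝ) / ((n : ℝ) - 2 * i))) +
        2 ^ (2 * (j + 1) + 1) * Real.sqrt (∏ i ∈ range (j + 1 + 1), ((2 * i + 1 : ℝ) / ((n : ℝ) - 2 * i))) +
        ∑ κ ∈ Ico (D / 2 + 1) (j + 1 + 1),
          (∏ i ∈ range κ, (((2 * c' + 1 : ℝ) - 2 * i) * ((n : ℝ) - 2 * c' - 1 - 2 * i) /
              (((2 * c' : ℝ) - 2 * i) * ((n : ℝ) - 2 * c' - 2 - 2 * i)))) *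
            Real.sqrt (∏ i ∈ range κ, ((2 * i + 1 : ℝ) / ((n : ℝ) - 2 * i)))) with htail
  -- the containment form as a pairing (brick 104 / 164)
  set α : OddSet n → Fin (n * n) → ℝ := fun U i =>
    (if (finProdFinEquiv.symm i).1 ∈ U.1 then (1 : ℝ) else 0) * (if (finProdFinEquiv.symm i).2 ∈ U.1 then (1 : ℝ) else 0) with hα
  set β : PMatch n → Fin (n * n) → ℝ := fun M i => v M (finProdFinEquiv.symm i).1 *
    (if s((finProdFinEquiv.symm i).1, (finProdFinEquiv.symm i).2) ∈ M.1 then (1 : ℝ) else 0) with hβ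
  have hdot : ∀ (U : OddSet n) (M : PMatch n), α U ⬝ᵥ β M =
      ∑ p, v M p * ((if p ∈ U.1 then (1 : ℝ) else 0) * (if M.2.partner p ∈ U.1 then (1 : ℝ) else 0)) := by
    intro U M
    unfold dotProduct
    rw [containment_eq_pairing U M (v M)]
    refine sum_congr rfl fun i _ => ?_
    simp only [hα, hβ]
    ring
  -- the degenerate case `G = 0` (then `f ≡ 0`)
  have U₀ : OddSet n := ⟨{⟨0, by omega⟩}, by simp⟩
  have hG0 : 0 ≤ G := (hf0 U₀).trans (hfG U₀)
  by_cases hGz : G = 0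
  · have hf00 : ∀ U, f U = 0 := fun U => le_antisymm ((hfG U).trans hGz.le) (hf0 U)
    have hL : ∑ U : OddSet n, ∑ M : PMatch n, levelWeight n (2 * c' + 1) C w U M *
        (f U * (∑ p, v M p * ((if p ∈ U.1 then (1 : ℝ) else 0) * (if M.2.partner p ∈ U.1 then (1 : ℝ) else 0))) ^ 2) = 0 :=
      sum_eq_zero fun U _ => sum_eq_zero fun M _ => by rw [hf00 U]; ring
    rw [hL, hGz]; simp
  have hG : 0 < G := lt_of_le_of_ne hG0 (Ne.symm hGz)
  -- the normalised vectors
  set a : OddSet n → Fin (n * n) → ℝ := fun U => Real.sqrt (f U / (G * N ^ 2)) • α U with ha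
  set b : PMatch n → Fin (n * n) → ℝ := fun M => (1 / Real.sqrt N) • β M with hb
  have hcU : ∀ U, 0 ≤ f U / (G * N ^ 2) := fun U => div_nonneg (hf0 U) (by positivity)
  have haa : ∀ U, a U ⬝ᵥ a U ≤ 1 := fun U => by
    rw [ha]
    simp only [smul_dotProduct, dotProduct_smul, smul_eq_mul]
    rw [← mul_assoc, ← sq, Real.sq_sqrt (hcU U)]
    calc f U / (G * N ^ 2) * (α U ⬝ᵥ α U) ≤ f U / (G * N ^ 2) * N ^ 2 :=
          mul_le_mul_of_nonneg_left (pairIndicator_dot_le U) (hcU U)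
      _ = f U / G := by field_simp
      _ ≤ 1 := (div_le_one hG).2 (hfG U)
  have hbb : ∀ M, b M ⬝ᵥ b M ≤ 1 := fun M => by
    rw [hb]
    simp only [smul_dotProduct, dotProduct_smul, smul_eq_mul]
    rw [← mul_assoc, ← sq, one_div, inv_pow, Real.sq_sqrt hNpos.le]
    calc N⁻¹ * (β M ⬝ᵥ β M) ≤ N⁻¹ * N :=
          mul_le_mul_of_nonneg_left (fieldEdge_dot_le M (v M) (hv1 M)) (inv_nonneg.2 hNpos.le)
      _ = 1 := inv_mul_cancel₀ hNpos.ne'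
  set X : OddSet n → Matrix (Fin (n * n)) (Fin (n * n)) ℝ := fun U => vecMulVec (a U) (a U) with hX
  set B : PMatch n → Matrix (Fin (n * n)) (Fin 1) ℝ := fun M => Matrix.of fun i _ => b M i with hB
  have hBB : ∀ M, B M * (B M)ᵀ = vecMulVec (b M) (b M) := fun M => by
    ext i k
    simp [hB, Matrix.mul_apply, vecMulVec_apply]
  have hXc : ∀ U, (X U).PosSemidef ∧ (1 - X U).PosSemidef := fun U =>
    ⟨posSemidef_vecMulVec _, posSemidef_one_sub_vecMulVec (haa U)⟩
  have hB1 : ∀ M, (1 - B M * (B M)ᵀ).PosSemidef := fun M => by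
    rw [hBB]; exact posSemidef_one_sub_vecMulVec (hbb M)
  have hBlow : IsLowDegreeM n (j + 1) B := fun i _ => by
    change (fun M : PMatch n => b M i) ∈ _
    have hmem := mul_edgeIndicator_mem_span (hv (finProdFinEquiv.symm i).1)
      s((finProdFinEquiv.symm i).1, (finProdFinEquiv.symm i).2)
    have heq : (fun M : PMatch n => b M i) = (1 / Real.sqrt N) • (fun M : PMatch n => v M (finProdFinEquiv.symm i).1 *
        (if s((finProdFinEquiv.symm i).1, (finProdFinEquiv.symm i).2) ∈ M.1 then (1 : ℝ) else 0)) := by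
      funext M; simp [hb, hβ]
    rw [heq]
    exact Submodule.smul_mem _ _ hmem
  -- brick 93 (matching-side SIGN at all degrees)
  have h93 := value_le_of_lowDegreeM_allModes hn hdes hD (k := j + 1) hDj hjc hjt hjnt X hXc B hBlow hB1
  -- the traces are the normalised containment forms
  have htr : ∀ (U : OddSet n) (M : PMatch n), G * N ^ 3 * (levelWeight n (2 * c' + 1) C w U M * (X U * (B M * (B M)ᵀ)).trace) =
      levelWeight n (2 * c' + 1) C w U M *
        (f U * (∑ p, v M p * ((if p ∈ U.1 then (1 : ℝ) else 0) * (if M.2.partner p ∈ U.1 then (1 : ℝ) else 0))) ^ 2) := by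
    intro U M
    rw [hBB, hX, trace_vecMulVec_mul_vecMulVec', ← hdot U M, ha, hb]
    simp only [smul_dotProduct, dotProduct_smul, smul_eq_mul]
    have hs1 : Real.sqrt (f U / (G * N ^ 2)) ^ 2 = f U / (G * N ^ 2) := Real.sq_sqrt (hcU U)
    have hs2 : Real.sqrt N ^ 2 = N := Real.sq_sqrt hNpos.le
    have key : G * N ^ 3 * (N⁻¹ * (f U / (G * N ^ 2))) = f U := by
      field_simp
    rw [show (1 / Real.sqrt N * (Real.sqrt (f U / (G * N ^ 2)) * (α U ⬝ᵥ β M))) ^ 2 =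
        (1 / Real.sqrt N) ^ 2 * (Real.sqrt (f U / (G * N ^ 2))) ^ 2 * (α U ⬝ᵥ β M) ^ 2 by ring,
      hs1, one_div, inv_pow, hs2]
    rw [show G * N ^ 3 * (levelWeight n (2 * c' + 1) C w U M * (N⁻¹ * (f U / (G * N ^ 2)) * (α U ⬝ᵥ β M) ^ 2)) =
        levelWeight n (2 * c' + 1) C w U M * ((G * N ^ 3 * (N⁻¹ * (f U / (G * N ^ 2)))) * (α U ⬝ᵥ β M) ^ 2) by ring, key]
  have hsum : ∑ U : OddSet n, ∑ M : PMatch n, levelWeight n (2 * c' + 1) C w U M *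
      (f U * (∑ p, v M p * ((if p ∈ U.1 then (1 : ℝ) else 0) * (if M.2.partner p ∈ U.1 then (1 : ℝ) else 0))) ^ 2) =
      G * N ^ 3 * ∑ U : OddSet n, ∑ M : PMatch n, levelWeight n (2 * c' + 1) C w U M * (X U * (B M * (B M)ᵀ)).trace := by
    rw [mul_sum]
    refine sum_congr rfl fun U _ => ?_
    rw [mul_sum]
    exact sum_congr rfl fun M _ => (htr U M).symm
  have hr : (((n * n : ℕ)) : ℝ) = N ^ 2 := by rw [hN]; push_cast; ring
  rw [hsum]
  calc G * N ^ 3 * ∑ U : OddSet n, ∑ M : PMatch n, levelWeight n (2 * c' + 1) C w U M * (X U * (B M * (B M)ᵀ)).trace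
      ≤ G * N ^ 3 * ((((n * n : ℕ)) : ℝ) * tail) := mul_le_mul_of_nonneg_left h93 (by positivity)
    _ = G * N ^ 5 * tail := by rw [hr]; ring


/-! ### §3 Pinned stars and window-local fields beyond the design degree -/

/-- Monotonicity of the matching-degree filtration: the span of the monomials `1[F ⊆ M]` with `|F| ≤ a` is contained in the one with `|F| ≤ b`
for `a ≤ b`. [cite: LeeRaghavendraSteurer2015, §5] -/
theorem span_monomials_mono {a b : ℕ} (hab : a ≤ b) :
    Submodule.span ℝ (Set.range fun F : {F : Finset (Sym2 (Fin n)) // F.card ≤ a} =>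
        fun M : PMatch n => if F.1 ⊆ M.1 then (1 : ℝ) else 0) ≤
      Submodule.span ℝ (Set.range fun F : {F : Finset (Sym2 (Fin n)) // F.card ≤ b} =>
        fun M : PMatch n => if F.1 ⊆ M.1 then (1 : ℝ) else 0) := by
  refine Submodule.span_mono ?_
  rintro g ⟨F, rfl⟩
  exact ⟨⟨F.1, F.2.trans hab⟩, rfl⟩

/-- **PINNED STARS BEYOND THE DESIGN DEGREE.** Let `n` be even, `(C, w)` an exact design of degree `D ≤ 2c'` on the `(2c'+1)`-cuts with variation
`≤ B_v`, `S` an edge set with `|S| ≤ j`, `D ≤ 2(j+1) ≤ c'`, `6(j+1)+1 ≤ 2c'+1`, `6(j+1)+1 ≤ n−(2c'+1)`, `0 ≤ f ≤ G` a mask and `|u_p| ≤ 1` a fixed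
direction. Then `Σ_U Σ_{M ⊇ S} W(U,M) f(U) C_u(U)² ≤ G·n⁵·(B_v√P_{D/2} + 2^{2(j+1)+1}√P_{j+1} + Σ_{κ∈(D/2,j+1]} R_κ√A_κ)`.
[cite: Potechin2019, Thm. 1.2 (LIPIcs 124, 61:4)] [cite: Rothvoss2017, §2 (PDF p. 6)] -/
theorem sum_star_containment_sq_le_allModes {c' T D : ℕ} {Bv : ℝ} {C : Finset ℕ} {w : ℕ → ℝ} (hn : Even n)
    (hdes : IsExactDesign n (2 * c' + 1) T D Bv C w) (hD : D ≤ 2 * c') {j : ℕ} (hDj : D ≤ 2 * (j + 1)) (hjc : 2 * (j + 1) ≤ c')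
    (hjt : 6 * (j + 1) + 1 ≤ 2 * c' + 1) (hjnt : 6 * (j + 1) + 1 ≤ n - (2 * c' + 1))
    (S : Finset (Sym2 (Fin n))) (hS : S.card ≤ j)
    (f : OddSet n → ℝ) {G : ℝ} (hf0 : ∀ U, 0 ≤ f U) (hfG : ∀ U, f U ≤ G) (u : Fin n → ℝ) (hu : ∀ p, |u p| ≤ 1) :
    ∑ U : OddSet n, ∑ M ∈ (univ : Finset (PMatch n)).filter (fun M => S ⊆ M.1), levelWeight n (2 * c' + 1) C w U M *
      (f U * (∑ p, u p * ((if p ∈ U.1 then (1 : ℝ) else 0) * (if M.2.partner p ∈ U.1 then (1 : ℝ) else 0))) ^ 2) ≤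
      G * (n : ℝ) ^ 5 * (Bv * Real.sqrt (∏ i ∈ range (D / 2 + 1), ((2 * i + 1 : ℝ) / ((n : ℝ) - 2 * i))) +
        2 ^ (2 * (j + 1) + 1) * Real.sqrt (∏ i ∈ range (j + 1 + 1), ((2 * i + 1 : ℝ) / ((n : ℝ) - 2 * i))) +
        ∑ κ ∈ Ico (D / 2 + 1) (j + 1 + 1),
          (∏ i ∈ range κ, (((2 * c' + 1 : ℝ) - 2 * i) * ((n : ℝ) - 2 * c' - 1 - 2 * i) /
              (((2 * c' : ℝ) - 2 * i) * ((n : ℝ) - 2 * c' - 2 - 2 * i)))) *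
            Real.sqrt (∏ i ∈ range κ, ((2 * i + 1 : ℝ) / ((n : ℝ) - 2 * i)))) := by
  classical
  have h := sum_containment_sq_le_of_lowDegreeField_allModes hn hdes hD hDj hjc hjt hjnt f hf0 hfG
    (fun M p => (if S ⊆ M.1 then (1 : ℝ) else 0) * u p) (fun M p => by
      show |(if S ⊆ M.1 then (1 : ℝ) else 0) * u p| ≤ 1
      split_ifs
      · rw [one_mul]; exact hu p
      · simp) (fun p => by
      have := smul_indicator_mem_span (n := n) S hS (u p)
      refine (congrArg (· ∈ _) ?_).mp this
      funext M; ring)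
  refine le_trans (le_of_eq ?_) h
  refine sum_congr rfl fun U _ => ?_
  rw [sum_filter]
  refine sum_congr rfl fun M _ => ?_
  by_cases hSM : S ⊆ M.1
  · simp only [hSM, if_true, one_mul]
  · simp only [hSM, if_false, zero_mul, sum_const_zero]
    ring

/-- **WINDOW-LOCAL FIELDS BEYOND THE DESIGN DEGREE.** Let `n` be even, `(C, w)` an exact design of degree `D ≤ 2c'` on the `(2c'+1)`-cuts with
variation `≤ B_v`, `H` a window with `|H| ≤ j`, `D ≤ 2(j+1) ≤ c'`, `6(j+1)+1 ≤ 2c'+1`, `6(j+1)+1 ≤ n−(2c'+1)`, `0 ≤ f ≤ G` a mask and `v` a field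
with `|v_M(p)| ≤ 1` depending on `M` only through its partners on `H`. Then
`Σ_U Σ_M W(U,M) f(U) C_{v_M}(U)² ≤ G·n⁵·(B_v√P_{D/2} + 2^{2(j+1)+1}√P_{j+1} + Σ_{κ∈(D/2,j+1]} R_κ√A_κ)`.
[cite: Potechin2019, Thm. 1.2 (LIPIcs 124, 61:4)] [cite: Rothvoss2017, §2 (PDF p. 6)] -/
theorem sum_containment_sq_le_of_local_allModes {c' T D : ℕ} {Bv : ℝ} {C : Finset ℕ} {w : ℕ → ℝ} (hn : Even n)
    (hdes : IsExactDesign n (2 * c' + 1) T D Bv C w) (hD : D ≤ 2 * c') {j : ℕ} (hDj : D ≤ 2 * (j + 1)) (hjc : 2 * (j + 1) ≤ c')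
    (hjt : 6 * (j + 1) + 1 ≤ 2 * c' + 1) (hjnt : 6 * (j + 1) + 1 ≤ n - (2 * c' + 1))
    (H : Finset (Fin n)) (hH : H.card ≤ j)
    (f : OddSet n → ℝ) {G : ℝ} (hf0 : ∀ U, 0 ≤ f U) (hfG : ∀ U, f U ≤ G) (v : PMatch n → Fin n → ℝ) (hv1 : ∀ M p, |v M p| ≤ 1)
    (hloc : ∀ M M' : PMatch n, (∀ h ∈ H, M.2.partner h = M'.2.partner h) → v M = v M') :
    ∑ U : OddSet n, ∑ M : PMatch n, levelWeight n (2 * c' + 1) C w U M *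
      (f U * (∑ p, v M p * ((if p ∈ U.1 then (1 : ℝ) else 0) * (if M.2.partner p ∈ U.1 then (1 : ℝ) else 0))) ^ 2) ≤
      G * (n : ℝ) ^ 5 * (Bv * Real.sqrt (∏ i ∈ range (D / 2 + 1), ((2 * i + 1 : ℝ) / ((n : ℝ) - 2 * i))) +
        2 ^ (2 * (j + 1) + 1) * Real.sqrt (∏ i ∈ range (j + 1 + 1), ((2 * i + 1 : ℝ) / ((n : ℝ) - 2 * i))) +
        ∑ κ ∈ Ico (D / 2 + 1) (j + 1 + 1),
          (∏ i ∈ range κ, (((2 * c' + 1 : ℝ) - 2 * i) * ((n : ℝ) - 2 * c' - 1 - 2 * i) /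
              (((2 * c' : ℝ) - 2 * i) * ((n : ℝ) - 2 * c' - 2 - 2 * i)))) *
            Real.sqrt (∏ i ∈ range κ, ((2 * i + 1 : ℝ) / ((n : ℝ) - 2 * i)))) :=
  sum_containment_sq_le_of_lowDegreeField_allModes hn hdes hD hDj hjc hjt hjnt f hf0 hfG v hv1
    (fun p => span_monomials_mono hH (local_mem_span H (fun M => v M p) (fun M M' hMM' => by rw [hloc M M' hMM'])))

end Summit.PneNP.PneNP.Theorems.ChebyshevTracialDesignPairContainmentLocalFieldsAllModes
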